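import Summits.QuantumFields.BalabanUV.Beta.GAN24.Push3
import Summits.QuantumFields.BalabanUV.Beta.GAN24.Push4Iter

/-!
# `BalabanUV.Beta.GAN24.Push3Nest` — binder row G-an2-4 / (CONV-C), S-slot road «SREC» (row owner gan24-p1-g12's `SKELETON-SREC.md` v0.1 §2 SR-L1;
# RULINGS-15 (R15-1) «SREC-PUSH3»): THE THREE-LEG PUSH NESTS —
# `push₃ l₁ r₁ w₁ (push₃ l₂ r₂ w₂ S) = push₃ (legComp l₂ l₁) (legComp r₂ r₁) (legComp w₂ w₁) S` (leaf-17's `Push4Nest.push₄_push₄` one table leg down)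

NOT IN PRINT; OUR BOOKKEEPING (G-an2-4 formalisation swarm, leaf prover `b2b-balaban-gan24-formalise-leaf-01`, gen 43; the row owner's RULINGS-15 (R15-1)
invitation, journal `CLAIMS.log` l.17352, claim l.17377; names PROVISIONAL).  HONEST FRAMING (cell contract, verbatim): «discharging `BetaPertH` makes
Bałaban's UV stability UNCONDITIONAL — a real constructive-QFT result; it is NOT the continuum limit and NOT the Clay problem.»  HONEST DEPENDENCY
(verbatim): «continuum YM on T⁴ ⇐ BetaPertH ∧ nine spine estimates (0/9 proved); BetaPertH ⇐ (D1) ∧ (D4) ∧ CAP+tail; G-an2-4 gates asym, D1 and NE2/3/4.»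

WHAT.  For leg families localised at positive rates (`Push4Bounds.LegDecay`: the OUTER triple `(l₁, r₁, w₁)` at blocking `N₁`, rate `m₁`; the INNER
triple `(l₂, r₂, w₂)` at blocking `N₂`, rate `m₂`) and a local stencil family `S` (`LocStencil S C δ`, `δ > 0`), the push of the push is ONE push through
the COMPOSITE legs (`Push4.legComp`, coarse ← middle ← fine; composite blocking `N₂·N₁`):
* §1 **`vertexW_push₃`** — the outer TABLE leg passes through the inner kernel legs and merges with the inner table leg:
  `vertexW w₁ (push₃ l₂ r₂ w₂ S) κ′ u′ = ffRead (Lk l₂ ∘ vertexW (legComp w₂ w₁) S κ′ u′ ∘ Rk r₂)` (leaf-17's dominated commutations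
  `Push4NestTable.vertexW_ffRead` / `vertexW_comp_right` / `vertexW_comp_left` / `vertexW_vertexW` BY NAME; majorants from
  `Push4NestAux.decays_vertexW_of_locStencil`);
* §2 **`push₃_push₃`** — then the KERNEL legs merge (`Push4NestAux.sandwich_ffRead` drops the inner ff-read; leaf-17's three dominated re-associations
  `Push4Nest.sandwich_nest` BY NAME, the middle kernel `vertexW (legComp w₂ w₁) S κ′ u′` being bi-localised at the composite dilated point by
  `Push4Bounds.biLoc_vertexW_keep` ∘ `Push4NestAux.legDecay_legComp`).  Every interchange is justified by exponential majorants derived from the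
  hypotheses; no rate or constant enters the STATEMENT.
Consequently the `k`-fold iterate of the linear part of a `push₃`-driven recursion (road «SREC»: the cubic line of the (E) recursion in the adopted
units, `SrecUnits.unitS_SrecAt_succ_cubic`) is a SINGLE three-leg push through `legComp`-chains of the one-step leg families — which families (dressed
response legs, `RespStepBm`) and their `LegDecay` data are SR-L1/SR-L4 of the road, not here.
[folklore]; 0 cited facts, 0 `Prop` mirrors, 0 definitions, 0 sorry.  Asserts NO shape of Bałaban's stencils; discharges NOTHING of (hS, hSall) on (E);
0 wall binders instantiated; NEVER «G-an2-4 closed»; NOT D1, NOT BetaPertH, NOT continuum, NOT Clay.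
-/

noncomputable section

open Finset
open scoped BigOperators
open Literature.MathematicalPhysics.QuantumFieldTheory
open Literature.MathematicalPhysics.QuantumFieldTheory.Balaban1983to89
open Literature.MathematicalPhysics.QuantumFieldTheory.Balaban1983to89.Beta
open B12Sec2to5 (l1 l1_nonneg)
open ExpKernelCalculus (MKer Decays BiLoc comp Zl Zl_nonneg)
open OneStepResolventKernel (Fib wsum LocStencil biLoc_mono)
open BalabanStepJets (locStencil_mono)
open BalabanCompositeJets (summable_slice_of_locStencil)
open Summit.QuantumFields.BalabanUV.Beta.GAN24.Push4 (legComp vertexW Lk Rk ffRead)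
open Summit.QuantumFields.BalabanUV.Beta.GAN24.Push4Bounds (LegDecay LegDecay.nonneg LegDecay.abs_le LegDecay.summable biLoc_vertexW_keep)
open Summit.QuantumFields.BalabanUV.Beta.GAN24.Push4NestTable (vertexW_ffRead vertexW_vertexW vertexW_comp_left vertexW_comp_right)
open Summit.QuantumFields.BalabanUV.Beta.GAN24.Push4NestAux (decays_vertexW_of_locStencil abs_le_of_decays abs_comp_Lk_le_of_decays summable_Lk_row
  summable_Rk_col legDecay_legComp sandwich_ffRead)
open Summit.QuantumFields.BalabanUV.Beta.GAN24.Push4Nest (sandwich_nest)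
open Summit.QuantumFields.BalabanUV.Beta.GAN24.Push4Iter (LegFam legChain legChain_zero legChain_succ legDecay_legChain)
open Summit.QuantumFields.BalabanUV.Beta.GAN24.AffineUnroll (transport transport_succ transport_zero)
open Summit.QuantumFields.BalabanUV.Beta.GAN24.Push3 (push₃ push₃_def)

namespace Summit.QuantumFields.BalabanUV.Beta.GAN24.Push3Nest

variable {d : ℕ}
variable {l₁ r₁ w₁ l₂ r₂ w₂ : Fin (d + 1) → (Fin (d + 1) → ℤ) → Fin (d + 1) → (Fin (d + 1) → ℤ) → ℝ} {N₁ N₂ : ℕ}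
  {Cl₁ Cr₁ Cw₁ Cl₂ Cr₂ Cw₂ m₁ m₂ C δ : ℝ}
  {S : Fin (d + 1) → (Fin (d + 1) → ℤ) → MKer (d + 1) (Fib d)}

/-! ## §1 The table leg of the nest: `vertexW w₁ (push₃ l₂ r₂ w₂ S) = ffRead (Lk l₂ ∘ vertexW (legComp w₂ w₁) S ∘ Rk r₂)` -/

/-- [folklore] **THE OUTER TABLE LEG PASSES THROUGH THE INNER PUSH AND MERGES WITH ITS TABLE LEG**:
`vertexW w₁ (push₃ l₂ r₂ w₂ S) κ′ u′ = ffRead (Lk l₂ ∘ vertexW (legComp w₂ w₁) S κ′ u′ ∘ Rk r₂)` — the table leg is already composite, the kernel legs still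
the inner ones.  (Outer weights summable in their fine index; inner legs bounded / summable; the inner table vertices decay at half the table's rate.) -/
theorem vertexW_push₃ (hw₁ : LegDecay w₁ N₁ Cw₁ m₁) (hl₂ : LegDecay l₂ N₂ Cl₂ m₂) (hr₂ : LegDecay r₂ N₂ Cr₂ m₂) (hw₂ : LegDecay w₂ N₂ Cw₂ m₂)
    (hm₁ : 0 < m₁) (hm₂ : 0 < m₂) (hS : LocStencil S C δ) (hδ : 0 < δ) (κ' : Fin (d + 1)) (u' : Fin (d + 1) → ℤ) :
    vertexW w₁ (push₃ l₂ r₂ w₂ S) κ' u' = ffRead (comp (comp (Lk l₂) (vertexW (legComp w₂ w₁) S κ' u')) (Rk r₂)) := by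
  -- data
  have hCl₂ := hl₂.nonneg
  have hCw₂ := hw₂.nonneg
  have hw₁s : ∀ μ y lam, Summable fun v => w₁ μ y lam v := fun μ y lam => hw₁.summable hm₁ μ y lam
  have hl₂b : ∀ α x' κ x, |l₂ α x' κ x| ≤ Cl₂ := fun α x' κ x => hl₂.abs_le hm₂.le α x' κ x
  have hw₂b : ∀ lam v κ u, |w₂ lam v κ u| ≤ Cw₂ := fun lam v κ u => hw₂.abs_le hm₂.le lam v κ u
  have hl₂s : ∀ α x' κ, Summable fun x => l₂ α x' κ x := fun α x' κ => hl₂.summable hm₂ α x' κ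
  have hr₂s : ∀ β z' κ, Summable fun z => r₂ β z' κ z := fun β z' κ => hr₂.summable hm₂ β z' κ
  -- the family of inner table vertices `H lam v := vertexW w₂ S lam v` decays at rate `δ/2`
  set H : Fin (d + 1) → (Fin (d + 1) → ℤ) → MKer (d + 1) (Fib d) := fun lam v => vertexW w₂ S lam v with hHdef
  have hHdec : ∀ lam v, Decays (H lam v) ((d + 1 : ℕ) * (Cw₂ * C * Zl (d + 1) (δ / 2))) (δ / 2) :=
    fun lam v => decays_vertexW_of_locStencil hw₂b hCw₂ hS hδ lam v
  -- through the inner `ffRead`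
  have e0 : push₃ l₂ r₂ w₂ S = fun lam v => ffRead (comp (comp (Lk l₂) (H lam v)) (Rk r₂)) := rfl
  rw [e0, vertexW_ffRead]
  congr 1
  -- through the inner right leg kernel
  have e1 : vertexW w₁ (fun lam v => comp (comp (Lk l₂) (H lam v)) (Rk r₂)) κ' u'
      = comp (vertexW w₁ (fun lam v => comp (Lk l₂) (H lam v)) κ' u') (Rk r₂) :=
    vertexW_comp_right (hw₁s κ' u') (fun z f b => summable_Rk_col hr₂s z f b)
      (fun lam v x w a f => abs_comp_Lk_le_of_decays hl₂b hCl₂ (hHdec lam v) (half_pos hδ) x w a f)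
  rw [e1]
  congr 1
  -- through the inner left leg kernel
  have e2 : vertexW w₁ (fun lam v => comp (Lk l₂) (H lam v)) κ' u' = comp (Lk l₂) (vertexW w₁ H κ' u') :=
    vertexW_comp_left (hw₁s κ' u') (fun x a f => summable_Lk_row hl₂s x a f)
      (fun lam v w z f b => abs_le_of_decays (hHdec lam v) (half_pos hδ).le w z f b)
  rw [e2]
  congr 1
  -- merge the outer table leg with the inner one: `vertexW w₁ (vertexW w₂ S) = vertexW (legComp w₂ w₁) S`
  exact vertexW_vertexW (hw₁s κ' u') hw₂b (fun κ x z a b => summable_slice_of_locStencil hS hδ κ x z a b)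

/-! ## §2 The nesting law -/

/-- [folklore] **THE THREE-LEG PUSH NESTS.**  For leg families localised at positive rates — the OUTER triple `(l₁, r₁, w₁)` at blocking `N₁`, the INNER
triple `(l₂, r₂, w₂)` at blocking `N₂` — and a local stencil family `S` at a positive rate:
`push₃ l₁ r₁ w₁ (push₃ l₂ r₂ w₂ S) κ′ u′ = push₃ (legComp l₂ l₁) (legComp r₂ r₁) (legComp w₂ w₁) S κ′ u′` (composite blocking `N₂·N₁`; leaf-17's
`Push4Nest.push₄_push₄` one table leg down).  No rate or constant enters the statement. -/
theorem push₃_push₃ (hl₁ : LegDecay l₁ N₁ Cl₁ m₁) (hr₁ : LegDecay r₁ N₁ Cr₁ m₁) (hw₁ : LegDecay w₁ N₁ Cw₁ m₁) (hl₂ : LegDecay l₂ N₂ Cl₂ m₂)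
    (hr₂ : LegDecay r₂ N₂ Cr₂ m₂) (hw₂ : LegDecay w₂ N₂ Cw₂ m₂) (hm₁ : 0 < m₁) (hm₂ : 0 < m₂) (hS : LocStencil S C δ) (hδ : 0 < δ)
    (κ' : Fin (d + 1)) (u' : Fin (d + 1) → ℤ) :
    push₃ l₁ r₁ w₁ (push₃ l₂ r₂ w₂ S) κ' u' = push₃ (legComp l₂ l₁) (legComp r₂ r₁) (legComp w₂ w₁) S κ' u' := by
  have hC : 0 ≤ C := (hS 0 0).nonneg (Sum.inl 0)
  -- a common composite rate `m'` for the composite legs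
  obtain ⟨m', hm'0, hm'₂, hm'₁⟩ : ∃ m' : ℝ, 0 < m' ∧ m' ≤ m₂ ∧ m' * N₂ < m₁ := by
    refine ⟨min m₂ (m₁ / (2 * ((N₂ : ℝ) + 1))), lt_min hm₂ (by positivity), min_le_left _ _, ?_⟩
    have hN : (0 : ℝ) ≤ N₂ := Nat.cast_nonneg _
    have hpos : (0 : ℝ) < 2 * ((N₂ : ℝ) + 1) := by positivity
    have h1 : min m₂ (m₁ / (2 * ((N₂ : ℝ) + 1))) * N₂ ≤ m₁ / (2 * ((N₂ : ℝ) + 1)) * N₂ :=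
      mul_le_mul_of_nonneg_right (min_le_right _ _) hN
    have h2 : m₁ / (2 * ((N₂ : ℝ) + 1)) * N₂ < m₁ := by
      calc m₁ / (2 * ((N₂ : ℝ) + 1)) * N₂ < m₁ / (2 * ((N₂ : ℝ) + 1)) * (2 * ((N₂ : ℝ) + 1)) :=
            mul_lt_mul_of_pos_left (by linarith) (div_pos hm₁ hpos)
        _ = m₁ := div_mul_cancel₀ _ hpos.ne'
    exact h1.trans_lt h2
  -- the composite table legs and the composite left kernel legs are localised at rate `m'`
  have hW : LegDecay (legComp w₂ w₁) (N₂ * N₁) ((d + 1 : ℕ) * (Cw₁ * Cw₂ * Zl (d + 1) (m₁ - m' * N₂))) m' :=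
    legDecay_legComp hw₁ hw₂ hm'0.le hm'₂ hm'₁
  have hL : LegDecay (legComp l₂ l₁) (N₂ * N₁) ((d + 1 : ℕ) * (Cl₁ * Cl₂ * Zl (d + 1) (m₁ - m' * N₂))) m' :=
    legDecay_legComp hl₁ hl₂ hm'0.le hm'₂ hm'₁
  -- a working rate for the middle kernel
  obtain ⟨δW, hδW0, hδWδ, hδWm⟩ : ∃ δW : ℝ, 0 < δW ∧ δW ≤ δ ∧ 2 * δW < m' := by
    refine ⟨min δ (m' / 4), lt_min hδ (by positivity), min_le_left _ _, ?_⟩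
    have := min_le_right δ (m' / 4); linarith
  -- the middle kernel `vertexW (legComp w₂ w₁) S κ′ u′` is bi-localised at the composite dilated point at rate `δW`
  have hV := biLoc_vertexW_keep hW (locStencil_mono hS hC hδWδ) hδW0.le hδWm κ' u'
  -- table legs, then kernel legs
  rw [push₃_def l₁ r₁ w₁, vertexW_push₃ hw₁ hl₂ hr₂ hw₂ hm₁ hm₂ hS hδ κ' u', sandwich_ffRead, push₃_def]
  exact congrArg ffRead (sandwich_nest hl₁ hr₁ hl₂ hr₂ hm₁ hm₂ hL hV hδW0 (by linarith) (by linarith))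

/-! ## §3 The k-fold iterate: the transport of a `push₃`-driven recursion is ONE push through the leg chains -/

/-- [folklore] A `LegDecay` bound weakens to any smaller rate (same constant). -/
theorem legDecay_mono {l : LegFam d} {N : ℕ} {Cl m m' : ℝ} (hl : LegDecay l N Cl m) (hm' : m' ≤ m) : LegDecay l N Cl m' :=
  fun α x' κ x => (hl α x' κ x).trans
    (mul_le_mul_of_nonneg_left (Real.exp_le_exp.2 (by nlinarith [l1_nonneg (x - (N : ℤ) • x')])) hl.nonneg)

/-- [folklore] **THE k-FOLD TRANSPORT OF THE THREE-LEG PUSH IS ONE THREE-LEG PUSH THROUGH THE LEG CHAINS.**  For leg families `l j`, `r j`, `w j`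
localised at positive rates at blocking `N ≥ 1` (every rate and constant EXISTENTIAL) and a local stencil family `S` at a positive rate,
`transport (fun j T ↦ push₃ (l j) (r j) (w j) T) m (k + 1) S = push₃ (legChain l m k) (legChain r m k) (legChain w m k) S`
(leaf-01's `AffineUnroll.transport`, leaf-17's `Push4Iter.legChain` = the `legComp`-chain of levels `m, …, m + k`, composite blocking `N^(k+1)`;
`push₃_push₃` at each step, `Push4Iter.legDecay_legChain` propagating the hypotheses along the chain).  The identity itself is rate-free. -/
theorem transport_push₃ {l r w : ℕ → LegFam d} {N : ℕ} (hN : 1 ≤ N) (hl : ∀ j, ∃ C m : ℝ, 0 < m ∧ LegDecay (l j) N C m)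
    (hr : ∀ j, ∃ C m : ℝ, 0 < m ∧ LegDecay (r j) N C m) (hw : ∀ j, ∃ C m : ℝ, 0 < m ∧ LegDecay (w j) N C m)
    (hS : ∃ C δ : ℝ, 0 < δ ∧ LocStencil S C δ) (m : ℕ) :
    ∀ k, transport (fun j T => push₃ (l j) (r j) (w j) T) m (k + 1) S = push₃ (legChain l m k) (legChain r m k) (legChain w m k) S
  | 0 => by simp [transport_succ, transport_zero, legChain_zero]
  | k + 1 => by
    rw [transport_succ, transport_push₃ hN hl hr hw hS m k, legChain_succ, legChain_succ, legChain_succ,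
      show m + (k + 1) = m + k + 1 from (Nat.add_assoc m k 1).symm]
    -- data at the outer level `m + k + 1` and for the chains
    obtain ⟨Cl₁, ml₁, hml₁, hl₁⟩ := hl (m + k + 1)
    obtain ⟨Cr₁, mr₁, hmr₁, hr₁⟩ := hr (m + k + 1)
    obtain ⟨Cw₁, mw₁, hmw₁, hw₁⟩ := hw (m + k + 1)
    obtain ⟨CL, mL, hmL, hL⟩ := legDecay_legChain hl m k
    obtain ⟨CR, mR, hmR, hR⟩ := legDecay_legChain hr m k
    obtain ⟨CW, mW, hmW, hW⟩ := legDecay_legChain hw m k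
    obtain ⟨C, δ, hδ, hSl⟩ := hS
    -- common rates per level (weaken to the minimum of the three)
    have hm₁ : 0 < min ml₁ (min mr₁ mw₁) := lt_min hml₁ (lt_min hmr₁ hmw₁)
    have hm₂ : 0 < min mL (min mR mW) := lt_min hmL (lt_min hmR hmW)
    have e1 : min ml₁ (min mr₁ mw₁) ≤ mr₁ := (min_le_right _ _).trans (min_le_left _ _)
    have e2 : min ml₁ (min mr₁ mw₁) ≤ mw₁ := (min_le_right _ _).trans (min_le_right _ _)
    have e3 : min mL (min mR mW) ≤ mR := (min_le_right _ _).trans (min_le_left _ _)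
    have e4 : min mL (min mR mW) ≤ mW := (min_le_right _ _).trans (min_le_right _ _)
    funext κ' u'
    exact push₃_push₃ (legDecay_mono hl₁ (min_le_left _ _)) (legDecay_mono hr₁ e1) (legDecay_mono hw₁ e2)
      (legDecay_mono hL (min_le_left _ _)) (legDecay_mono hR e3) (legDecay_mono hW e4) hm₁ hm₂ hSl hδ κ' u'

end Summit.QuantumFields.BalabanUV.Beta.GAN24.Push3Nest

end
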